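import Summits.Schanuel.Schanuel.Theorems.RootDecomp1KSiegelFunctions03

/-!
# RootDecomp1KSiegelFunctions — lens 1, generation 71, NODE 31 «THE HEIGHT BINDER HALVED: `HeightComparison ⟸ SiegelFunctionsAll`, ARITHMETIC HALF PROVED» (×0-AS-RECORD + one contingent ×1 at FLOOR G (a) — PRICE 31 L3149, RULING L3160, NODE L3172, VERDICT L3175): the node-12 hypothesis binder `HeightComparison` (Weil–Siegel height comparison on a plane curve) is, definitionally, `∀ P, GeomIrreducible P → 1 ≤ xdeg P → 1 ≤ deg_Y P → HeightComparisonAt P`, and `heightComparisonAt_of_siegelFunctions` PROVES `HeightComparisonAt P` from the GEOMETRIC datum `SiegelFunctions P ∧ SiegelFunctions (swap P)` (two integral functions of controlled degree for every b ≥ 1); the ARITHMETIC half (rational-root integrality, archimedean root bound, `h(y^b) = b·h(y)`, finite exceptional fibres by Bezout, exchange of variables) is proved sorry-free; hence `heightComparison_of_siegelFunctionsAll : SiegelFunctionsAll → HeightComparison` and the node-12 heads re-pointed BY NAME; the geometric half `SiegelFunctionsAll` is a typed HYPOTHESIS (plan S1–S6 in the docstring of `SiegelFunctions`), NOT proved;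 (G)-instances by hand: `parabP` / its transpose / `hyperbP`, and the infinite family 𝒞₃ = {(x·Y − 1)² − f(x) : f cubic, f(0) ≠ 1} in BOTH charts (Lucas trace; the 3 × 3 POWER LEMMA), its geometric irreducibility, and the HYPOTHESIS-FREE `heightComparisonAt_sqLinP` / `thinFibreAt_two_sqLinP` — ×0-AS-RECORD toolkit per RULING L3160 (every 𝒞₃ member is also decided by the numerator lever); `PadicSubspace`, items 33364 / 33363 / 31077 / 31987 and the tally UNMOVED — continuation (RootDecomp1KSiegelFunctions04): §5  The variables exchanged (Mathlib `Bivariate.swap`, over `ℤ`), irreducibility of the `ℚ`-model, — 13 declarations `coeff_coeff_swap` … `heightComparison_of_siegelFunctions`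

(lens-1 g71 NODE 31 «THE HEIGHT BINDER HALVED» L3172: HOME kernel K = HOME/decomp-schanuel-lens-1/g71/lean/SiegelFunctions.lean sha256 4f39c136…, 1983 l, 207 decls (173 theorems + 34 defs by the critic's count, VERDICT L3175; NODE's «208» an e-lite), ONE namespace `Summit.Schanuel.Schanuel.Theorems.RootDecomp1KSiegelFunctions` (inner anonymous-free sections `PowerLemma` / `Chart2` / `GeomIrreducible` with their `variable`s kept whole inside one part each), imports EXACTLY the tree port …RootDecomp1KHeightGrading02 (node 12: `HeightComparison`, `HeightDecidedAt`, `GeomIrreducible`, `logHt` BY TREE NAME) + `Literature.NumberTheory.DiophantineGeometry.PlaneCurveBezoutWeak` + `Mathlib.RingTheory.Polynomial.RationalRoot`; no private / instance / set_option / notation / sorry / new axiom / native_decide / [cite; lens farm rc 0 · 0 errors · 0 sorries · dupNamespace warnings only; `#print axioms` = [propext, Classical.choice, Quot.sound] on the nine probed heads (g71/out/ax_*.json), Probe g71/out/ProbeK.lean 2659bdec… rc 0 (rfl pin `HeightComparison` = tree), CONTROLS A / A0 / B rc 1 as designed (ctrlA 4ae3a6d6… / ctrlA0 ff875685… / ctrlB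 f20add70…), memo g71/NODE-g71.md 07fb49f8…, SHA256SUMS 34 files; CLAIM 31 L3146; crit PRICE 31 L3149 (×0-as-record + one contingent ×1 at FLOOR G; CHECKLIST K-g71; RULES K-R59 / K-R60 pre-announced); lens ASK-FIRST FAMILY CLAIM L3158 (𝒞₃) and crit RULING L3160 (𝒞₃ REFUSED as a FLOOR-G (b) family: numerator lever, NUMEXP; toolkit ×0 under K-R60 (i)); census INSTRUMENT NOTES 54–56 L3161 / L3163 / L3167 (LIVENESS-v46 / v47 / v48: rows 75–77 = 𝒞₃ members, keys numexp / numexp_tight / k60) and crit ACKs L3165 / L3168; writer NOTES 4 / 5 L3162 / L3173; crit-1 (g13) VERDICT 31 L3175: «NODE 31 = ×0-AS-RECORD BOOKED; CHECKLIST K-g71 (J1)–(J7) MET; the contingent THEOREM ×1 REGISTERED under K-R59 (ii), UNPAID (FLOOR G unmet); RULES K-R59 and K-R60 (i)–(iv) FIXED; PORT GO» — kernel re-verified by the critic (farm rc 0 · 0 errors · 0 sorries; 207 decls = 173 theorems + 34 defs; axioms standard re-probed on 27 heads), record: piece C227 «HeightComparison ⟸ SiegelFunctionsAll», the K-line binder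 HeightComparison henceforth CONSUMED through heightComparison_of_siegelFunctionsAll (Dom re-pointing BY NAME, antecedent count unchanged), 𝒞₃ / InC3 decided hypothesis-free by thinFibreAt_of_inC3 / thinFibreAt_two_sqLinP = the K-R60 (i) kernel shape (TOOLKIT, ×0, never payable), tally UNCHANGED lens-1 ×22 + THEOREM ×24, EXHIBITS ρ1 / ρ2 VACANT, 33364 / 33363 / 31077 / 31987 OPEN rung 0. Port by census-1 gen 26 as `RootDecomp1KSiegelFunctions01–09` (files ≤ 400 lines; chain 01 ← the three K imports, 0k ← 0(k−1); `--supports stmt-Schanuel-33364`, the item stays OPEN; ×0 record port — the geometric binder `SiegelFunctions` / `SiegelFunctionsAll` appears ONLY as an explicit hypothesis of the `…_of_siegelFunctions…` heads, never an axiom / instance / variable; no credit anywhere; the section-aligned 9-part split is lens-1's port plan (J7) re-built by the census pipeline): 01 = K-port l.1–216 (§0 / §1) — 25 decls `ratModel`, `QDvd`, `relPoly`, …, `evalEval_ratModel_relPoly`; 02 = K-port l.219–450 (§2) — 20 decls `scaledEval`, `l1`, `l1_nonneg`, …, `abs_le_of_rel`; 03 = K-port l.453–658 (§3 / §4) — 9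 decls `HtQ_pow`, `logHt_pow`, `HtQ_intDiv_le`, …, `upperComparisonAt_of_siegelFunctions`; 04 = K-port l.661–830 (§5) — 13 decls `coeff_coeff_swap`, `map_swap`, `natDegree_swap`, …, `heightComparison_of_siegelFunctions`; 05 = K-port l.833–1105 (§6 / §7) — 28 decls `thinFibreAt_of_heightComparisonAt`, `thinFibreAt_of_heightComparison'`, `thinFibreAt_of_siegelFunctions`, …, `siegelFunctions_toys`; 06 = K-port l.1107–1300 (§8) — 20 decls `sqLinP`, `sqLinP_eq`, `natDegree_sqLinP`, …, `thinFibreAt_sqLinP_of_swap`; 07 = K-port l.1302–1547 (§9) — 35 decls `compM`, `cubic`, `cubic_eq`, …, `natDegree_det3_compM_pow_le`; 08 = K-port l.1549–1856 (§10) — 40 decls `q₃`, `q₂`, `q₁`, …, `heightComparisonAt_sqLinP_of_geomIrreducible`; 09 = K-port l.1858–2074 (§11 / §12) — 17 decls `sqLinK`, `coeff_sqLinK`, `natDegree_sqLinK`, …, `thinFibreAt_of_inC3`. 91 one-line docstrings synthesised for undocumented helper declarations (statements quoted); ONE port-side modifier of record: `sum_Icc_half_pow` (§2, part 02) is `private`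 with a PORT NOTE after the `dedup.landed` bounce p850627 (≡ `Literature.Computability.Cryptography.HashDom.sum_Icc_half_pow`); everything else = K VERBATIM (statements, names, proofs, K's module docstring kept in part 01 below this provenance block).)
-/

noncomputable section

namespace Summit.Schanuel.Schanuel.Theorems.RootDecomp1KSiegelFunctions

open Polynomial
open scoped Nat
open Summit.Schanuel.Schanuel.Theorems.RootDecomp1KDegreeLadder (bev xdeg natDegree_coeff_le_xdeg ThinFibreAt ThinFibre
  thinFibreAt_of_natDegree_lt)
open Summit.Schanuel.Schanuel.Theorems.RootDecomp1KHeightGrading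

/-! ### §5  The variables exchanged (Mathlib `Bivariate.swap`, over `ℤ`), irreducibility of the `ℚ`-model,
THE TWO-SIDED COMPARISON, and the binder discharged from `SiegelFunctionsAll` -/

/-- coefficients of the swapped polynomial (any commutative ring; the Literature twin `Dioph.coeff_coeff_swap` is
stated over a field). -/
theorem coeff_coeff_swap {R : Type*} [CommRing R] (F : R[X][X]) (i j : ℕ) :
    ((Bivariate.swap F).coeff i).coeff j = (F.coeff j).coeff i := by
  induction F using Polynomial.induction_on' with
  | add p q hp hq => simp only [map_add, coeff_add, hp, hq]
  | monomial n a =>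
    induction a using Polynomial.induction_on' with
    | add p q hp hq => simp only [map_add, coeff_add, hp, hq]
    | monomial m r =>
      rw [Bivariate.swap_monomial_monomial]
      simp only [coeff_monomial]
      split_ifs <;> simp_all [coeff_monomial]

/-- naturality: exchanging the variables commutes with a change of the coefficient ring. -/
theorem map_swap {R S : Type*} [CommRing R] [CommRing S] (f : R →+* S) (F : R[X][X]) :
    (Bivariate.swap F).map (mapRingHom f) = Bivariate.swap (F.map (mapRingHom f)) := by
  ext i j
  simp only [coeff_map, coe_mapRingHom, coeff_coeff_swap]

/-- `deg_Y (swap P) = xdeg P`. -/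
theorem natDegree_swap (P : ℤ[X][X]) : (Bivariate.swap P).natDegree = xdeg P := by
  refine le_antisymm ?_ ?_
  · rw [natDegree_le_iff_coeff_eq_zero]
    intro N hN
    ext j
    rw [coeff_coeff_swap, coeff_zero]
    exact coeff_eq_zero_of_natDegree_lt ((natDegree_coeff_le_xdeg P j).trans_lt (by exact_mod_cast hN))
  · unfold xdeg
    refine Finset.sup_le fun j _ => ?_
    by_cases h0 : P.coeff j = 0
    · simp [h0]
    · refine le_natDegree_of_ne_zero fun h => ?_
      have h1 := congrArg (fun q : ℤ[X] => q.coeff j) h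
      simp only [coeff_coeff_swap, coeff_zero, coeff_natDegree] at h1
      exact (leadingCoeff_ne_zero.mpr h0) h1

/-- `xdeg (swap P) = deg_Y P`. -/
theorem xdeg_swap (P : ℤ[X][X]) : xdeg (Bivariate.swap P) = P.natDegree := by
  refine le_antisymm ?_ ?_
  · unfold xdeg
    refine Finset.sup_le fun j _ => ?_
    rw [natDegree_le_iff_coeff_eq_zero]
    intro N hN
    rw [coeff_coeff_swap, coeff_eq_zero_of_natDegree_lt (p := P) (n := N) hN, coeff_zero]
  · by_cases hP : P = 0
    · subst hP; simp
    · have hlc : P.coeff P.natDegree ≠ 0 := leadingCoeff_ne_zero.mpr hP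
      set j := (P.coeff P.natDegree).natDegree with hj
      have hne : ((Bivariate.swap P).coeff j).coeff P.natDegree ≠ 0 := by
        rw [coeff_coeff_swap, hj, coeff_natDegree]
        exact leadingCoeff_ne_zero.mpr hlc
      exact (le_natDegree_of_ne_zero hne).trans (natDegree_coeff_le_xdeg _ j)

/-- the `ℚ`-model of the swapped curve is the swapped `ℚ`-model. -/
theorem ratModel_swap (P : ℤ[X][X]) : ratModel (Bivariate.swap P) = Bivariate.swap (ratModel P) :=
  map_swap _ _

/-- the rational points of the swapped curve are the transposed rational points. -/
theorem bev_swap_eq_zero_iff (P : ℤ[X][X]) (x y : ℚ) :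
    bev (Bivariate.swap P) x y = 0 ↔ bev P y x = 0 := by
  rw [bev_eq_zero_iff_ratModel, bev_eq_zero_iff_ratModel, ratModel_swap,
    Literature.NumberTheory.DiophantineGeometry.Dioph.evalEval_swap]

/-- geometric irreducibility is invariant under the exchange of variables. -/
theorem geomIrreducible_swap_iff (P : ℤ[X][X]) : GeomIrreducible (Bivariate.swap P) ↔ GeomIrreducible P := by
  unfold GeomIrreducible
  rw [map_swap]
  exact MulEquiv.irreducible_iff _

/-- the geometric model is the base change of the `ℚ`-model. -/
theorem geomModel_eq_map_ratModel (P : ℤ[X][X]) :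
    P.map (mapRingHom (algebraMap ℤ (AlgebraicClosure ℚ))) =
      (ratModel P).map (mapRingHom (algebraMap ℚ (AlgebraicClosure ℚ))) := by
  rw [ratModel, Polynomial.map_map, mapRingHom_comp]
  congr 2

/-- **GEOMETRICALLY IRREDUCIBLE ⇒ IRREDUCIBLE OVER `ℚ`** (for `deg_Y P ≥ 1`): the `ℚ`-model is primitive over
`ℚ[x]` (a constant factor would survive the base change) and Gauss-type descent of irreducibility along the injective
base change `ℚ[x] → ℚ̄[x]` (Mathlib `IsPrimitive.irreducible_of_irreducible_map_of_injective`). -/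
theorem irreducible_ratModel_of_geomIrreducible {P : ℤ[X][X]} (hgi : GeomIrreducible P) (hn : 1 ≤ P.natDegree) :
    Irreducible (ratModel P) := by
  set K := AlgebraicClosure ℚ
  have hφ : Function.Injective (mapRingHom (algebraMap ℚ K) : ℚ[X] →+* K[X]) :=
    map_injective _ (algebraMap ℚ K).injective
  have hgi' : Irreducible ((ratModel P).map (mapRingHom (algebraMap ℚ K))) := by
    rw [← geomModel_eq_map_ratModel]; exact hgi
  have hdegQ : (ratModel P).natDegree = P.natDegree :=
    natDegree_map_eq_of_injective (map_injective _ (Int.castRingHom ℚ).injective_int) P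
  have hdegK : ((ratModel P).map (mapRingHom (algebraMap ℚ K))).natDegree = P.natDegree := by
    rw [natDegree_map_eq_of_injective hφ, hdegQ]
  have hprimK := hgi'.isPrimitive (by rw [hdegK]; omega)
  have hprim : (ratModel P).IsPrimitive := by
    rw [isPrimitive_iff_isUnit_of_C_dvd]
    intro r hr
    have h1 : C (r.map (algebraMap ℚ K)) ∣ (ratModel P).map (mapRingHom (algebraMap ℚ K)) := by
      have := map_dvd (mapRingHom (mapRingHom (algebraMap ℚ K))) hr
      simpa [Polynomial.map_C] using this
    have h2 := isPrimitive_iff_isUnit_of_C_dvd.mp hprimK _ h1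
    rw [isUnit_iff_degree_eq_zero, degree_map] at h2
    exact isUnit_iff_degree_eq_zero.mpr h2
  exact hprim.irreducible_of_irreducible_map_of_injective hφ hgi'

/-- two one-sided comparisons (for `P` and for `swap P`) give the two-sided comparison at `P`. -/
theorem heightComparisonAt_of_upper {P : ℤ[X][X]} (hn : 1 ≤ P.natDegree) (h₁ : UpperComparisonAt P)
    (h₂ : UpperComparisonAt (Bivariate.swap P)) : HeightComparisonAt P := by
  intro ε hε
  set n : ℝ := (P.natDegree : ℝ) with hndef
  set k : ℝ := (xdeg P : ℝ) with hkdef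
  have hn1 : (1 : ℝ) ≤ n := by rw [hndef]; exact_mod_cast hn
  have hk0 : (0 : ℝ) ≤ k := by rw [hkdef]; exact Nat.cast_nonneg _
  have hn0 : 0 < n := by linarith
  have hkε : 0 < k + ε := by linarith
  obtain ⟨c₁, hc₁⟩ := h₁ ε hε
  set ε' : ℝ := ε * n / (k + ε) with hε'
  have hε'0 : 0 < ε' := by positivity
  obtain ⟨c₂, hc₂⟩ := h₂ ε' hε'0
  refine ⟨|c₁| + |c₂| + ε' * |c₁| / n, fun x y hxy => ?_⟩
  have hx0 := logHt_nonneg x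
  have hy0 := logHt_nonneg y
  have e₁ := hc₁ x y hxy
  have hyx : bev (Bivariate.swap P) (y : ℝ) (x : ℝ) = 0 := (bev_swap_eq_zero_iff P y x).mpr hxy
  have e₂ := hc₂ y x hyx
  rw [natDegree_swap, xdeg_swap] at e₂
  rw [← hndef, ← hkdef] at e₁ e₂
  have hc₁' : c₁ ≤ |c₁| := le_abs_self _
  have hc₂' : c₂ ≤ |c₂| := le_abs_self _
  have hkey : ε' * (k + ε) = ε * n := by rw [hε']; field_simp
  have e₃ : ε' * logHt y ≤ ε * logHt x + ε' * |c₁| / n := by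
    have h4 : n * (ε' * logHt y) ≤ n * (ε * logHt x + ε' * |c₁| / n) := by
      calc n * (ε' * logHt y) = ε' * (n * logHt y) := by ring
        _ ≤ ε' * ((k + ε) * logHt x + c₁) := mul_le_mul_of_nonneg_left e₁ hε'0.le
        _ = ε * n * logHt x + ε' * c₁ := by rw [← hkey]; ring
        _ ≤ ε * n * logHt x + ε' * |c₁| := by nlinarith
        _ = n * (ε * logHt x + ε' * |c₁| / n) := by field_simp
    exact le_of_mul_le_mul_left h4 hn0
  have hpos : 0 ≤ ε' * |c₁| / n := by positivity
  have ha₁ := abs_nonneg c₁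
  have ha₂ := abs_nonneg c₂
  rw [abs_sub_le_iff]
  constructor
  · linarith
  · linarith

/-- **THE HEIGHT COMPARISON AT ONE CURVE FROM ITS SIEGEL FUNCTIONS** (both charts): for a geometrically
irreducible `P` with Siegel functions on `P` and on `swap P`, `HeightComparisonAt P` holds — PROVED. -/
theorem heightComparisonAt_of_siegelFunctions {P : ℤ[X][X]} (hgi : GeomIrreducible P) (hk : 1 ≤ xdeg P)
    (hn : 1 ≤ P.natDegree) (hS : SiegelFunctions P) (hS' : SiegelFunctions (Bivariate.swap P)) :
    HeightComparisonAt P :=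
  heightComparisonAt_of_upper hn
    (upperComparisonAt_of_siegelFunctions (irreducible_ratModel_of_geomIrreducible hgi hn) hS)
    (upperComparisonAt_of_siegelFunctions (irreducible_ratModel_of_geomIrreducible
      ((geomIrreducible_swap_iff P).mpr hgi) (by rw [natDegree_swap]; exact hk)) hS')

/-- **THE BINDER HALVED**: node 12's binder `HeightComparison` FOLLOWS from the pure function-field statement
`SiegelFunctionsAll` — the arithmetic half (integrality, archimedean root bound, weak Bézout, the two charts) is
PROVED here; what remains open in the tree is the geometric half only. -/
theorem heightComparison_of_siegelFunctionsAll (h : SiegelFunctionsAll) : HeightComparison :=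
  fun P hgi hk hn => heightComparisonAt_of_siegelFunctions hgi hk hn (h P hgi hk hn)
    (h _ ((geomIrreducible_swap_iff P).mpr hgi) (by rw [xdeg_swap]; exact hn)
      (by rw [natDegree_swap]; exact hk))

/-- the same head with the hypothesis UNFOLDED (checklist K-g71 (J1), verbatim shape). -/
theorem heightComparison_of_siegelFunctions
    (h : ∀ P : ℤ[X][X], GeomIrreducible P → 1 ≤ xdeg P → 1 ≤ P.natDegree → SiegelFunctions P) :
    HeightComparison :=
  heightComparison_of_siegelFunctionsAll h

end Summit.Schanuel.Schanuel.Theorems.RootDecomp1KSiegelFunctions
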